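import Summits.Ventures.LatticeQCDFlow.Exactness.FlowSamplerSymmetrisationMixedParity
import HarnessLib

/-!
# The harmonic-mean bound for a random alternation of exact updates is SHARP in the `τ_int` format: equality `τ_M(g) + ½ = 1/Σᵢ αᵢ/(τᵢ(g) + ½)` on a common eigen-ray — attained by alternating the raw and the symmetrised flow sampler of the mixed-parity witness (`40/27 = HM(4/3, 5/3)`)

HONEST FRAMING: exact (Metropolis-corrected) sampling algorithms for lattice gauge theory;
figures of merit are autocorrelation/cost numbers at stated couplings and volumes; no
continuum-physics claim.  (SCALAR calibration rung S0-A: not a gauge result.)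

Venture `LatticeQCDFlow` (cell pub-lqcd), topic `Exactness`; FANOUT row 2 (`s0-phi4`).  NEW WORK of the
cell in the tree's `τ_int` format (`Scoring.tauInt ρ = ½ + Σ_{t≥1} ρ(t)`, normalised autocorrelations
`ρ(n) = ∫ g (Kⁿg) w / ∫ g² w`).  The cell's harmonic-mean theorems (`ReversibleMixtureHarmonicMean`,
`FlowSamplerMixtureHarmonicMean`, finite state `ReversibleKernelMixtureHarmonicMean`) bound the
random alternation `M = Σ αᵢKᵢ` of exact updates by `τ_M + ½ ≤ 1/Σ αᵢ/(τᵢ + ½)`.  Here, with no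
hypothesis beyond linearity on one ray: the bound is an EQUALITY whenever the observable spans a
common eigen-ray of the components.

* `iterate_of_eigenRay`, `autocorr_of_eigenRay`, **`tauInt_add_half_of_eigenRay`** — if
  `K(c·g) = (λc)·g` for all real `c` and `∫ g² w ≠ 0`, then `ρ(n) = λⁿ` and, for `|λ| < 1`, the series
  is summable with **`τ(g) + ½ = 1/(1 − λ)`**;
* `mixN_eigenRay` — `M(c·g) = (λ̄c)·g`, `λ̄ = Σ αᵢλᵢ`, for `M f = Σ αᵢ Kᵢ f`;
* **`tauInt_mixN_add_half_eq_harmonicMean_of_eigenRay`** — `αᵢ ≥ 0`, `Σ αᵢ = 1`, `|λᵢ| < 1` ⇒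
  **`τ_M(g) + ½ = 1/Σᵢ αᵢ/(τᵢ(g) + ½)`** (both sides `= 1/(1 − λ̄)`): EQUALITY in the harmonic-mean bound;
* **`witness_alternation_tauInt`** — the mixed-parity witness of `FlowSamplerSymmetrisationMixedParity`
  (three states, counting measure, `w ≡ 1`, flow `q̃ = (1/20, 3/5, 7/20)`, its `(0 2)`-symmetrisation
  `q̃ₛ = (1/5, 3/5, 1/5)`, `g = (0, −1, 1)` with `K_q̃ g = ¼g`, `K_{q̃ₛ} g = ⅖g`, `τ = 5/6` and `7/6`):
  the 50/50 ALTERNATION of the two exact flow samplers has **`τ(g) + ½ = 40/27`** — exactly the harmonic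
  mean of `4/3` and `5/3` — i.e. `τ(g) = 53/54`, strictly between `5/6` and `7/6`.

Nothing is cited as a fact.  NOT CLAIMED: equality off common eigen-rays (generically the bound is
strict); anything about a lattice run; any value for any network.
-/

namespace Summit.Ventures.LatticeQCDFlow.Exactness

open Real MeasureTheory Filter Finset Topology
open Summit.Ventures.LatticeQCDFlow.Scoring

section General

variable {X : Type*} [MeasurableSpace X] {μ : Measure X} {w g : X → ℝ}
  {K : (X → ℝ) → (X → ℝ)} {lam : ℝ}

omit [MeasurableSpace X] in
/-- Iterates on an eigen-ray: `K(c·g) = (λc)·g` for all `c` ⇒ `Kⁿ(c·g) = (cλⁿ)·g`. -/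
theorem iterate_of_eigenRay (hK : ∀ c : ℝ, K (fun t => c * g t) = fun t => lam * c * g t) (n : ℕ)
    (c : ℝ) : K^[n] (fun t => c * g t) = fun t => c * lam ^ n * g t := by
  induction n generalizing c with
  | zero => funext t; simp
  | succ n ih =>
    rw [Function.iterate_succ_apply, hK, ih]
    funext t
    ring

/-- Normalised autocorrelations on an eigen-ray: `ρ(n) = λⁿ` (`∫ g² w ≠ 0`). -/
theorem autocorr_of_eigenRay (hK : ∀ c : ℝ, K (fun t => c * g t) = fun t => lam * c * g t)
    (hP : ∫ x, g x ^ 2 * w x ∂μ ≠ 0) (n : ℕ) :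
    (∫ x, g x * (K^[n] g) x * w x ∂μ) / ∫ x, g x ^ 2 * w x ∂μ = lam ^ n := by
  have e : g = fun t => 1 * g t := funext fun t => by ring
  conv_lhs => rw [e, iterate_of_eigenRay hK n 1]
  have e2 : ∀ x, (fun t => 1 * g t) x * (fun t => 1 * lam ^ n * g t) x * w x
      = lam ^ n * ((fun t => 1 * g t) x ^ 2 * w x) := fun x => by simp only; ring
  simp_rw [e2]
  rw [integral_const_mul, mul_div_assoc, div_self, mul_one]
  simpa using hP

/-- **`τ + ½ = 1/(1 − λ)` on an eigen-ray with `|λ| < 1`** (the series is summable, geometric). -/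
theorem tauInt_add_half_of_eigenRay (hK : ∀ c : ℝ, K (fun t => c * g t) = fun t => lam * c * g t)
    (hP : ∫ x, g x ^ 2 * w x ∂μ ≠ 0) (hlam : |lam| < 1) :
    (Summable fun n => (∫ x, g x * (K^[n + 1] g) x * w x ∂μ) / ∫ x, g x ^ 2 * w x ∂μ) ∧
    tauInt (fun n => (∫ x, g x * (K^[n] g) x * w x ∂μ) / ∫ x, g x ^ 2 * w x ∂μ) + 1 / 2
      = 1 / (1 - lam) := by
  simp only [autocorr_of_eigenRay hK hP]
  have h := hasSum_geometric_succ hlam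
  refine ⟨h.summable, ?_⟩
  rw [tauInt_geometric hlam]
  have h1 : (1 : ℝ) - lam ≠ 0 := by
    have := (abs_lt.mp hlam).2
    exact ne_of_gt (by linarith)
  field_simp
  ring

omit [MeasurableSpace X] in
/-- The random alternation on a common eigen-ray: `M(c·g) = (λ̄c)·g`, `λ̄ = Σ αᵢλᵢ`. -/
theorem mixN_eigenRay {ι : Type*} [Fintype ι] {Kf : ι → (X → ℝ) → (X → ℝ)} {lams : ι → ℝ}
    {α : ι → ℝ} {M : (X → ℝ) → (X → ℝ)}
    (hK : ∀ i (c : ℝ), Kf i (fun t => c * g t) = fun t => lams i * c * g t)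
    (hM : ∀ f x, M f x = ∑ i, α i * Kf i f x) (c : ℝ) :
    M (fun t => c * g t) = fun t => (∑ i, α i * lams i) * c * g t := by
  funext t
  rw [hM, Finset.sum_mul, Finset.sum_mul]
  exact Finset.sum_congr rfl fun i _ => by rw [hK i c]; ring

omit [MeasurableSpace X] in
/-- `|Σ αᵢλᵢ| < 1` for a convex combination of numbers of modulus `< 1`. -/
theorem abs_convexComb_lt_one {ι : Type*} [Fintype ι] {α lams : ι → ℝ} (hα : ∀ i, 0 ≤ α i)
    (hα1 : ∑ i, α i = 1) (hl : ∀ i, |lams i| < 1) : |∑ i, α i * lams i| < 1 := by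
  have h1 : |∑ i, α i * lams i| ≤ ∑ i, α i * |lams i| := by
    refine (Finset.abs_sum_le_sum_abs _ _).trans (le_of_eq ?_)
    exact Finset.sum_congr rfl fun i _ => by rw [abs_mul, abs_of_nonneg (hα i)]
  have h2 : ∑ i, α i * |lams i| < ∑ i, α i := by
    have hle : ∀ i ∈ Finset.univ, α i * |lams i| ≤ α i := fun i _ => by
      have := hl i
      nlinarith [hα i, abs_nonneg (lams i)]
    obtain ⟨j, hj⟩ : ∃ j, 0 < α j := by
      by_contra h
      have h' : ∀ i, α i ≤ 0 := fun i => le_of_not_gt fun hi => h ⟨i, hi⟩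
      have : ∑ i, α i ≤ 0 := Finset.sum_nonpos fun i _ => h' i
      linarith
    exact Finset.sum_lt_sum hle ⟨j, Finset.mem_univ j, by nlinarith [hl j, abs_nonneg (lams j)]⟩
  rw [hα1] at h2
  exact lt_of_le_of_lt h1 h2

/-- **EQUALITY IN THE HARMONIC-MEAN BOUND ON A COMMON EIGEN-RAY.**  `Kᵢ(c·g) = (λᵢc)·g` for all `c`
and `i`, `|λᵢ| < 1`, `αᵢ ≥ 0`, `Σ αᵢ = 1`, `M f = Σ αᵢ Kᵢ f`, `∫ g² w ≠ 0`.  Then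
`τ_M(g) + ½ = 1/Σᵢ αᵢ/(τᵢ(g) + ½)`. -/
theorem tauInt_mixN_add_half_eq_harmonicMean_of_eigenRay {ι : Type*} [Fintype ι]
    {Kf : ι → (X → ℝ) → (X → ℝ)} {lams : ι → ℝ} {α : ι → ℝ} {M : (X → ℝ) → (X → ℝ)}
    (hK : ∀ i (c : ℝ), Kf i (fun t => c * g t) = fun t => lams i * c * g t)
    (hM : ∀ f x, M f x = ∑ i, α i * Kf i f x) (hα : ∀ i, 0 ≤ α i) (hα1 : ∑ i, α i = 1)
    (hl : ∀ i, |lams i| < 1) (hP : ∫ x, g x ^ 2 * w x ∂μ ≠ 0) :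
    tauInt (fun n => (∫ x, g x * (M^[n] g) x * w x ∂μ) / ∫ x, g x ^ 2 * w x ∂μ) + 1 / 2
      = 1 / ∑ i, α i / (tauInt (fun n => (∫ x, g x * ((Kf i)^[n] g) x * w x ∂μ)
          / ∫ x, g x ^ 2 * w x ∂μ) + 1 / 2) := by
  have hMray : ∀ c : ℝ, M (fun t => c * g t) = fun t => (∑ i, α i * lams i) * c * g t :=
    mixN_eigenRay hK hM
  have hbar : |∑ i, α i * lams i| < 1 := abs_convexComb_lt_one hα hα1 hl
  rw [(tauInt_add_half_of_eigenRay hMray hP hbar).2]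
  have hi : ∀ i, tauInt (fun n => (∫ x, g x * ((Kf i)^[n] g) x * w x ∂μ) / ∫ x, g x ^ 2 * w x ∂μ)
      + 1 / 2 = 1 / (1 - lams i) := fun i => (tauInt_add_half_of_eigenRay (hK i) hP (hl i)).2
  simp_rw [hi]
  have e : ∑ i, α i / (1 / (1 - lams i)) = 1 - ∑ i, α i * lams i := by
    have h1 : ∀ i, α i / (1 / (1 - lams i)) = α i - α i * lams i := fun i => by
      rw [div_div_eq_mul_div, div_one]; ring
    simp only [h1, Finset.sum_sub_distrib, hα1]
  rw [e]

end General

/-! ## The witness: alternating the raw and the symmetrised flow sampler attains the harmonic mean -/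

/-- **`τ + ½ = 40/27 = HM(4/3, 5/3)`** for `g = (0, −1, 1)` under the 50/50 alternation of the exact
flow samplers with proposals `q̃ = (1/20, 3/5, 7/20)` and `q̃ₛ = (1/5, 3/5, 1/5)` (uniform target on
three states): `τ = 53/54`, strictly between the components' `5/6` and `7/6`. -/
theorem witness_alternation_tauInt {M : (Fin 3 → ℝ) → (Fin 3 → ℝ)}
    (hM : ∀ f x, M f x = ∑ i : Fin 2, (![1 / 2, 1 / 2] : Fin 2 → ℝ) i
      * (![imhOp (Measure.count : Measure (Fin 3)) (fun _ => (1 : ℝ)) (![1 / 20, 3 / 5, 7 / 20]),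
          imhOp (Measure.count : Measure (Fin 3)) (fun _ => (1 : ℝ))
            (fun s => ((![1 / 20, 3 / 5, 7 / 20] : Fin 3 → ℝ) s
              + (![1 / 20, 3 / 5, 7 / 20] : Fin 3 → ℝ) (Equiv.swap (0 : Fin 3) 2 s)) / 2)]
          : Fin 2 → (Fin 3 → ℝ) → (Fin 3 → ℝ)) i f x) :
    tauInt (fun n => (∫ x, (![0, -1, 1] : Fin 3 → ℝ) x * (M^[n] (![0, -1, 1] : Fin 3 → ℝ)) x
        * (fun _ : Fin 3 => (1 : ℝ)) x ∂Measure.count)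
        / ∫ x, (![0, -1, 1] : Fin 3 → ℝ) x ^ 2 * (fun _ : Fin 3 => (1 : ℝ)) x ∂Measure.count) + 1 / 2
      = 40 / 27 := by
  have hK : ∀ (i : Fin 2) (c : ℝ),
      (![imhOp (Measure.count : Measure (Fin 3)) (fun _ => (1 : ℝ)) (![1 / 20, 3 / 5, 7 / 20]),
          imhOp (Measure.count : Measure (Fin 3)) (fun _ => (1 : ℝ))
            (fun s => ((![1 / 20, 3 / 5, 7 / 20] : Fin 3 → ℝ) s
              + (![1 / 20, 3 / 5, 7 / 20] : Fin 3 → ℝ) (Equiv.swap (0 : Fin 3) 2 s)) / 2)]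
          : Fin 2 → (Fin 3 → ℝ) → (Fin 3 → ℝ)) i (fun t => c * (![0, -1, 1] : Fin 3 → ℝ) t)
        = fun t => (![1 / 4, 2 / 5] : Fin 2 → ℝ) i * c * (![0, -1, 1] : Fin 3 → ℝ) t := by
    intro i c
    fin_cases i
    · show imhOp (Measure.count : Measure (Fin 3)) (fun _ => (1 : ℝ)) (![1 / 20, 3 / 5, 7 / 20])
          (fun t => c * (![0, -1, 1] : Fin 3 → ℝ) t)
        = fun t => (1 / 4 : ℝ) * c * (![0, -1, 1] : Fin 3 → ℝ) t
      rw [MixedParityWitness.imhOp_qW_smul_gW]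
      funext t; ring
    · show imhOp (Measure.count : Measure (Fin 3)) (fun _ => (1 : ℝ))
          (fun s => ((![1 / 20, 3 / 5, 7 / 20] : Fin 3 → ℝ) s
            + (![1 / 20, 3 / 5, 7 / 20] : Fin 3 → ℝ) (Equiv.swap (0 : Fin 3) 2 s)) / 2)
          (fun t => c * (![0, -1, 1] : Fin 3 → ℝ) t)
        = fun t => (2 / 5 : ℝ) * c * (![0, -1, 1] : Fin 3 → ℝ) t
      rw [MixedParityWitness.imhOp_qWs_smul_gW]
      funext t; ring
  have hP : ∫ t, (![0, -1, 1] : Fin 3 → ℝ) t ^ 2 * (fun _ : Fin 3 => (1 : ℝ)) t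
      ∂(Measure.count : Measure (Fin 3)) ≠ 0 := by
    rw [MixedParityWitness.sqNorm_gW]; norm_num
  have hα : ∀ i : Fin 2, 0 ≤ (![1 / 2, 1 / 2] : Fin 2 → ℝ) i := fun i => by fin_cases i <;> simp
  have hα1 : ∑ i : Fin 2, (![1 / 2, 1 / 2] : Fin 2 → ℝ) i = 1 := by simp [Fin.sum_univ_two]; norm_num
  have hl : ∀ i : Fin 2, |(![1 / 4, 2 / 5] : Fin 2 → ℝ) i| < 1 := fun i => by
    fin_cases i <;> simp [abs_of_pos] <;> norm_num
  rw [tauInt_mixN_add_half_eq_harmonicMean_of_eigenRay hK hM hα hα1 hl hP]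
  have h0 := (tauInt_add_half_of_eigenRay (hK 0) hP (hl 0)).2
  have h1 := (tauInt_add_half_of_eigenRay (hK 1) hP (hl 1)).2
  simp only [Fin.sum_univ_two]
  rw [h0, h1]
  simp
  norm_num

end Summit.Ventures.LatticeQCDFlow.Exactness
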